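import Mathlib.Analysis.Calculus.Implicit
import Mathlib.Geometry.Manifold.MFDeriv.SpecificFunctions
import Literature.Analysis.Calculus.SardManifold
import Literature.NumberTheory.Transcendental.ComplexFormsPullback
import HarnessLib

/-!
# Holomorphic maps onto a neighbourhood in a regular level set are immersive somewhere

Layer `Literature/Geometry/Kaehler` (complex manifolds charted on a complex normed space `E`,
holomorphic = `MDifferentiable` for `𝓘(ℂ, E)`, as in `HolomorphicChartForms`). Motivation: the
non-vanishing of Griffiths' residue form on a smooth hypersurface
(`Literature.AlgebraicGeometry.HodgeTheory.Voisin2003_hypersurface_residueForm`; the pulled-back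
residue `ψ^* Res_Y(PΩ/F)` is non-zero wherever the differential of the affine coordinates of `ψ`
is injective). The tree's proof of that step (`HodgeTheory/HypersurfaceResidueFormNonzero`,
`injective_liftDeriv`) uses the INJECTIVITY of `ψ` and the Clements–Osgood theorem; this file
records the measure-theoretic alternative, which needs no injectivity and is GENERIC complex
analysis — no projective space, no polynomials:

* `exists_injective_mfderiv_of_nonempty_interior` (**equidimensional Sard, holomorphic form**):
  a holomorphic map `f : U → F` (`U ⊆ M` open, `M` a second-countable complex manifold with
  `dim_ℂ M = dim_ℂ F`) whose image has non-empty interior has an injective complex differential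
  somewhere (the real statement `Literature.Analysis.Calculus.exists_surjective_mfderiv_of_nonempty_interior`,
  Milnor (1965) §2–§3, read through `mfderiv_real_eq_restrictScalars`);
* `exists_clm_isOpen_image_levelSet` (**local structure of a regular level set**, from Mathlib's
  implicit function theorem `HasStrictFDerivAt.implicitToOpenPartialHomeomorphOfComplemented`,
  any complete field `𝕜`): at a point `v₀` where `φ : V → 𝕜` has a non-zero strict derivative
  `φ'`, there are a continuous linear retraction `π : V → ker φ'` and an open `O ∋ v₀` such that
  `π` maps every relatively open piece `{φ = φ v₀} ∩ O'`, `O' ⊆ O` open, onto an OPEN subset of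
  `ker φ'` (the level set is a graph over `ker φ'` near `v₀`); `finrank_ker_add_one`:
  `dim ker φ' + 1 = dim V`;
* `exists_injective_mfderiv_of_levelSet_subset_image` (**the immersivity lemma**): if a
  holomorphic `g : U → F`, `dim_ℂ F = dim_ℂ M + 1`, has image containing a neighbourhood
  `{φ = φ(g x₀)} ∩ W` of `g x₀` in a level set of `φ : F → ℂ` regular at `g x₀`, then `dg_x` is
  injective at some `x ∈ U` — apply the first result to `π ∘ g : U → ker φ'`, whose image contains
  the open set `π({φ = φ(g x₀)} ∩ O ∩ W)`. No injectivity or properness of `g` is needed.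

For the hypersurface `Y = {F = 0} ⊂ ℙ^{m+1}(ℂ)` one takes `g` = the affine coordinates of `ψ` on
`ψ⁻¹(U_i)`, `φ` = the dehomogenised equation `f_i` (regular on `Y ∩ U_i` by the Jacobian
criterion and Euler's identity) and `W = univ`.

## References

* J. Milnor, *Topology from the Differentiable Viewpoint* (1965), §2 p. 10, §3 pp. 16–17 (Sard's
  theorem for maps of manifolds; Brown's corollary). [MilnorTDV1965]
* C. Voisin, *Hodge Theory and Complex Algebraic Geometry II* (2003), §6.1 (context: residues of
  hypersurfaces). [VoisinHodgeII2003]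
-/

noncomputable section

open Set Function Filter Module
open scoped Manifold Topology

namespace Literature.Geometry.Kaehler

/-! ### Equidimensional Sard for holomorphic maps -/

section RealOfComplex

variable {E : Type*} [NormedAddCommGroup E] [NormedSpace ℂ E]
  {M : Type*} [TopologicalSpace M] [ChartedSpace E M]
  {F : Type*} [NormedAddCommGroup F] [NormedSpace ℂ F]

/-- A holomorphic map is real-differentiable on the same open set (pointwise
`MDifferentiableAt.real_of_complex`). [cite: VoisinHodgeI2002, §2.2.1] -/
theorem mdifferentiableOn_real_of_complex {f : M → F} {U : Set M} (hU : IsOpen U)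
    (hf : MDifferentiableOn 𝓘(ℂ, E) 𝓘(ℂ, F) f U) :
    MDifferentiableOn 𝓘(ℝ, E) 𝓘(ℝ, F) f U := fun x hx ↦
  ((hf x hx).mdifferentiableAt (hU.mem_nhds hx)).real_of_complex.mdifferentiableWithinAt

end RealOfComplex

section ComplexSard

variable {E : Type*} [NormedAddCommGroup E] [NormedSpace ℂ E] [FiniteDimensional ℂ E]
  {M : Type*} [TopologicalSpace M] [ChartedSpace E M]
  [IsManifold 𝓘(ℝ, E) 1 M]
  {F : Type*} [NormedAddCommGroup F] [NormedSpace ℂ F] [FiniteDimensional ℂ F]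

/-- **Equidimensional Sard for holomorphic maps (regular points exist).** Let `M` be a
second-countable manifold charted on the complex space `E` (only the real `C¹` structure
`IsManifold 𝓘(ℝ, E) 1 M` is used), `F` a complex normed space with
`finrank ℂ E = finrank ℂ F`, and `f` holomorphic on the open set `U ⊆ M`. If `f(U)` has non-empty
interior, then the complex differential `df_x : E → F` is injective (equivalently bijective) at
some point `x ∈ U`. (The real differential is the complex one with scalars restricted,
`Literature.NumberTheory.Transcendental.mfderiv_real_eq_restrictScalars`, so this is the real
statement `Literature.Analysis.Calculus.exists_surjective_mfderiv_of_nonempty_interior`.)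
[cite: MilnorTDV1965, §2 p. 10 and §3 Corollary (Brown) p. 17] -/
theorem exists_injective_mfderiv_of_nonempty_interior [SecondCountableTopology M]
    (hEF : finrank ℂ E = finrank ℂ F) {f : M → F} {U : Set M} (hU : IsOpen U)
    (hf : MDifferentiableOn 𝓘(ℂ, E) 𝓘(ℂ, F) f U) (hint : (interior (f '' U)).Nonempty) :
    ∃ x ∈ U, Injective (mfderiv 𝓘(ℂ, E) 𝓘(ℂ, F) f x) := by
  have hEF' : finrank ℝ E = finrank ℝ F := by
    rw [finrank_real_of_complex, finrank_real_of_complex, hEF]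
  obtain ⟨x, hxU, hx⟩ :=
    Literature.Analysis.Calculus.exists_surjective_mfderiv_of_nonempty_interior (I := 𝓘(ℝ, E))
      hEF' hU (mdifferentiableOn_real_of_complex hU hf) hint
  refine ⟨x, hxU, ?_⟩
  have hfx : MDifferentiableAt 𝓘(ℂ, E) 𝓘(ℂ, F) f x := (hf x hxU).mdifferentiableAt (hU.mem_nhds hxU)
  rw [Literature.NumberTheory.Transcendental.mfderiv_real_eq_restrictScalars hfx] at hx
  have hx' : Surjective (show E →L[ℂ] F from mfderiv 𝓘(ℂ, E) 𝓘(ℂ, F) f x) := hx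
  exact (LinearMap.injective_iff_surjective_of_finrank_eq_finrank
    (f := (show E →L[ℂ] F from mfderiv 𝓘(ℂ, E) 𝓘(ℂ, F) f x).toLinearMap) hEF).mpr hx'

end ComplexSard

/-! ### Regular level sets are locally graphs: the implicit function theorem -/

section LevelSet

variable {𝕜 : Type*} [NontriviallyNormedField 𝕜]
  {V : Type*} [NormedAddCommGroup V] [NormedSpace 𝕜 V]

/-- A non-zero continuous linear functional is onto. [folklore] -/
theorem range_eq_top_of_ne_zero {φ' : V →L[𝕜] 𝕜} (hφ' : φ' ≠ 0) : φ'.range = ⊤ := by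
  obtain ⟨v, hv⟩ : ∃ v, φ' v ≠ 0 := by
    by_contra h
    push Not at h
    exact hφ' (ContinuousLinearMap.ext h)
  refine LinearMap.range_eq_top.mpr fun t ↦ ⟨(t / φ' v) • v, ?_⟩
  change φ' ((t / φ' v) • v) = t
  rw [map_smul, smul_eq_mul, div_mul_cancel₀ t hv]

/-- Rank–nullity for a non-zero functional: `dim ker φ' + 1 = dim V`. [folklore] -/
theorem finrank_ker_add_one [FiniteDimensional 𝕜 V] {φ' : V →L[𝕜] 𝕜} (hφ' : φ' ≠ 0) :
    finrank 𝕜 φ'.ker + 1 = finrank 𝕜 V := by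
  have h := LinearMap.finrank_range_add_finrank_ker (φ' : V →ₗ[𝕜] 𝕜)
  have hr : finrank 𝕜 (LinearMap.range (φ' : V →ₗ[𝕜] 𝕜)) = 1 := by
    rw [show LinearMap.range (φ' : V →ₗ[𝕜] 𝕜) = ⊤ from range_eq_top_of_ne_zero hφ', finrank_top,
      Module.finrank_self]
  rw [hr, add_comm] at h
  exact h

/-- **Local structure of a regular level set** (implicit function theorem). Let `φ : V → 𝕜` have
the non-zero strict derivative `φ'` at `v₀` (`𝕜` a complete field, `V` a Banach space). Then
there are a continuous linear retraction `π : V → ker φ'` (identity on `ker φ'`) and an open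
neighbourhood `O` of `v₀` such that for every open `O' ⊆ O` the set `π({φ = φ v₀} ∩ O')` is open
in `ker φ'`: the homeomorphism `Θ(v) = (φ v, π(v - v₀))` of Mathlib's
`HasStrictFDerivAt.implicitToOpenPartialHomeomorphOfComplemented` straightens the level set on
`O = source Θ` to the vertical slice `{φ v₀} × ker φ'`. [folklore] -/
theorem exists_clm_isOpen_image_levelSet [CompleteSpace 𝕜] [CompleteSpace V]
    {φ : V → 𝕜} {φ' : V →L[𝕜] 𝕜} {v₀ : V} (hφ : HasStrictFDerivAt φ φ' v₀) (hφ' : φ' ≠ 0) :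
    ∃ (π : V →L[𝕜] φ'.ker) (O : Set V), IsOpen O ∧ v₀ ∈ O ∧ (∀ k : φ'.ker, π k = k) ∧
      ∀ O' ⊆ O, IsOpen O' → IsOpen (π '' ({v | φ v = φ v₀} ∩ O')) := by
  have hrange : φ'.range = ⊤ := range_eq_top_of_ne_zero hφ'
  have hker : φ'.ker.ClosedComplemented :=
    φ'.ker_closedComplemented_of_finiteDimensional_range
  set Θ := hφ.implicitToOpenPartialHomeomorphOfComplemented φ φ' hrange hker with hΘ
  set π : V →L[𝕜] φ'.ker := Classical.choose hker with hπ
  refine ⟨π, Θ.source, Θ.open_source,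
    hφ.mem_implicitToOpenPartialHomeomorphOfComplemented_source hrange hker,
    fun k ↦ Classical.choose_spec hker k, fun O' hO' hO'open ↦ ?_⟩
  have hT : IsOpen (Θ '' O') := Θ.isOpen_image_of_subset_source hO'open hO'
  have hΘapply : ∀ v, Θ v = (φ v, π (v - v₀)) := fun v ↦
    hφ.implicitToOpenPartialHomeomorphOfComplemented_apply hrange hker v
  have key : π '' ({v | φ v = φ v₀} ∩ O') =
      (fun k : φ'.ker ↦ k + π v₀) '' {k | (φ v₀, k) ∈ Θ '' O'} := by
    ext k
    constructor
    · rintro ⟨v, ⟨hv, hvO⟩, rfl⟩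
      refine ⟨π v - π v₀, ⟨v, hvO, ?_⟩, sub_add_cancel _ _⟩
      rw [hΘapply, map_sub]
      exact Prod.ext hv rfl
    · rintro ⟨k, ⟨v, hvO, hv⟩, rfl⟩
      rw [hΘapply, Prod.mk.injEq, map_sub] at hv
      refine ⟨v, ⟨hv.1, hvO⟩, ?_⟩
      rw [← hv.2]
      exact (sub_add_cancel _ _).symm
  rw [key]
  exact (Homeomorph.addRight (π v₀)).isOpenMap _
    (hT.preimage (continuous_const.prodMk continuous_id))

end LevelSet

/-! ### The immersivity lemma -/

section Immersive

variable {E : Type*} [NormedAddCommGroup E] [NormedSpace ℂ E] [FiniteDimensional ℂ E]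
  {M : Type*} [TopologicalSpace M] [ChartedSpace E M]
  [IsManifold 𝓘(ℝ, E) 1 M]
  {F : Type*} [NormedAddCommGroup F] [NormedSpace ℂ F] [FiniteDimensional ℂ F]

/-- **A holomorphic map covering a neighbourhood in a regular hypersurface is immersive
somewhere.** Let `M` be a second-countable complex manifold charted on `E`, `F` a complex normed
space with `finrank ℂ E + 1 = finrank ℂ F`, `g` holomorphic on the open `U ⊆ M`, `x₀ : M`, and
`φ : F → ℂ` strictly differentiable at `g x₀` with non-zero derivative `φ'`. If the image `g(U)`
contains the piece `{φ = φ (g x₀)} ∩ W` of the level set through `g x₀`, for some open `W ∋ g x₀`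
(so in particular `g x₀ ∈ g(U)`; `x₀ ∈ U` itself is not needed), then `dg_x` is injective at some
`x ∈ U`. Proof: with `π, O` from
`exists_clm_isOpen_image_levelSet`, the holomorphic map `π ∘ g : U → ker φ'` (equal dimensions)
has image containing the non-empty open set `π({φ = φ(g x₀)} ∩ (O ∩ W))`, so by the holomorphic
Sard lemma `exists_injective_mfderiv_of_nonempty_interior` some `d(π ∘ g)_x = π ∘ dg_x` is
injective. (For Griffiths' residue on `Y = {F = 0}`: `g` = affine coordinates of the model map,
`φ` = the dehomogenised equation, `W = univ`.) [cite: MilnorTDV1965, §3 Corollary (Brown) p. 17] -/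
theorem exists_injective_mfderiv_of_levelSet_subset_image [SecondCountableTopology M]
    (hEF : finrank ℂ E + 1 = finrank ℂ F) {g : M → F} {U : Set M} (hU : IsOpen U)
    (hg : MDifferentiableOn 𝓘(ℂ, E) 𝓘(ℂ, F) g U) {x₀ : M}
    {φ : F → ℂ} {φ' : F →L[ℂ] ℂ} (hφ : HasStrictFDerivAt φ φ' (g x₀)) (hφ' : φ' ≠ 0)
    {W : Set F} (hW : IsOpen W) (hgW : g x₀ ∈ W)
    (hsub : {v | φ v = φ (g x₀)} ∩ W ⊆ g '' U) :
    ∃ x ∈ U, Injective (mfderiv 𝓘(ℂ, E) 𝓘(ℂ, F) g x) := by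
  haveI : CompleteSpace F := FiniteDimensional.complete ℂ F
  obtain ⟨π, O, hO, hx₀O, -, hopen⟩ := exists_clm_isOpen_image_levelSet hφ hφ'
  -- the open piece of `ker φ'` covered by `π ∘ g`
  set A : Set φ'.ker := π '' ({v | φ v = φ (g x₀)} ∩ (O ∩ W)) with hA
  have hAopen : IsOpen A := hopen (O ∩ W) inter_subset_left (hO.inter hW)
  have hAne : A.Nonempty := ⟨π (g x₀), g x₀, ⟨rfl, hx₀O, hgW⟩, rfl⟩
  have hAsub : A ⊆ (π ∘ g) '' U := by
    rintro _ ⟨v, ⟨hv, -, hvW⟩, rfl⟩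
    obtain ⟨x, hxU, rfl⟩ := hsub ⟨hv, hvW⟩
    exact ⟨x, hxU, rfl⟩
  have hint : (interior ((π ∘ g) '' U)).Nonempty :=
    hAne.mono (interior_maximal hAsub hAopen)
  -- equidimensional Sard for the holomorphic map `π ∘ g`
  have hdim : finrank ℂ E = finrank ℂ φ'.ker := by
    have := finrank_ker_add_one hφ'
    omega
  have hπg : MDifferentiableOn 𝓘(ℂ, E) 𝓘(ℂ, φ'.ker) (π ∘ g) U :=
    π.mdifferentiable.comp_mdifferentiableOn hg
  obtain ⟨x, hxU, hx⟩ := exists_injective_mfderiv_of_nonempty_interior hdim hU hπg hint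
  refine ⟨x, hxU, ?_⟩
  have hgx : MDifferentiableAt 𝓘(ℂ, E) 𝓘(ℂ, F) g x := (hg x hxU).mdifferentiableAt (hU.mem_nhds hxU)
  rw [mfderiv_comp x π.mdifferentiableAt hgx, ContinuousLinearMap.mfderiv_eq] at hx
  exact Injective.of_comp hx

end Immersive

end Literature.Geometry.Kaehler

end
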